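import Summits.KontsevichZagierPeriods.KontsevichZagierPeriods.Theorems.RootDecompQuadraticDescentPair18HomotopyAngP15

/-! # `RootDecompQuadraticDescentPair18HomotopyAngP16` — part 16/20 of the mechanical ≤400-line split of `Pair18HomotopyAng_v13_landing.lean` (sha256 01bf0af4c8d09f43…)
Source: decomp-kz lens-6 g9 `Pair18HomotopyAng.lean` v13 (HOME/decomp-kz-lens-6/g9/, sha256 bd7fcda1…; critic g5 19:35:56Z CLEARED «angle side of #18 PROVED»: hTh7_holds, hB17_holds, hAng4_holds with no hypotheses) — companion file #2 of Pair18Homotopy v14 (landed as …Pair18HomotopyP01–P31): the verbatim COPIED PRELUDE is dropped in favour of those landed declarations, the four homonyms with different bodies are renamed (Th7_eq', TriA, isSemialgebraic_TriA, volume_diag'), `#print axioms` pins removed.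
Split by census-1 g9 `gen/splitlean.py`: scopes re-opened with their `open`/`variable`/`set_option` context; mathematics and declaration order unchanged. -/

set_option linter.unusedSimpArgs false
noncomputable section
open _root_.Set MvPolynomial
namespace Summit.KontsevichZagierPeriods.RootDecompQuadraticDescent.Pair18Homotopy
open Literature.NumberTheory.Transcendental
open Literature.NumberTheory.Transcendental.KZ (RFun cube)
open Summit.KontsevichZagierPeriods.RootDecompQuadraticDescent.DarkPairs (rel_reflect_rep rel_double)
section Fold
open Literature.ModelTheory.ExponentialFields (IsSemialgebraic isSemialgebraic_setOf_eval_le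
  isSemialgebraic_setOf_eval_pos isSemialgebraic_setOf_eval_nonneg isSemialgebraic_setOf_eval_eq_zero)

open _root_.Set MvPolynomial in
open Literature.NumberTheory.Transcendental in
open Literature.NumberTheory.Transcendental.KZ (RFun cube) in
open Summit.KontsevichZagierPeriods.RootDecompQuadraticDescent.DarkPairs (rel_reflect_rep rel_double) in
/-- Auxiliary step `vec2_1` (§2b): vec2 1. [bookkeeping] -/
private theorem vec2_1 (a b : ℝ) : (![a, b] : Fin 2 → ℝ) 1 = b := rfl

open _root_.Set MvPolynomial in
open Literature.NumberTheory.Transcendental in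
open Literature.NumberTheory.Transcendental.KZ (RFun cube) in
open Summit.KontsevichZagierPeriods.RootDecompQuadraticDescent.DarkPairs (rel_reflect_rep rel_double) in
/-- Auxiliary step `vec2_0` (§2b): vec2 0. [bookkeeping] -/
private theorem vec2_0 (a b : ℝ) : (![a, b] : Fin 2 → ℝ) 0 = a := rfl

open _root_.Set MvPolynomial in
open Literature.NumberTheory.Transcendental in
open Literature.NumberTheory.Transcendental.KZ (RFun cube) in
open Summit.KontsevichZagierPeriods.RootDecompQuadraticDescent.DarkPairs (rel_reflect_rep rel_double) in
/-- Auxiliary step `cube2` (§0): cube2. [bookkeeping] -/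
private theorem cube2 {x : Fin 2 → ℝ} (hx : x ∈ KZ.cube 2) : (0 ≤ x 0 ∧ x 0 ≤ 1) ∧ (0 ≤ x 1 ∧ x 1 ≤ 1) := ⟨hx 0, hx 1⟩

set_option maxHeartbeats 1600000 in
/-- **The lattice translation as a KZ-move**: for `S, T ⊆ [0,1]²` with `1 + 7c·x > 0` on `S`, `7c·x < 1` on `T`,
`Tr c (S) ⊆ T`, `Ur c (T) ⊆ S`: `[W₇ | S] ≡ [W₇ | T]`. -/
theorem W7_translate (c : ℚ) {S T : Set (Fin 2 → ℝ)} (hS : IsSemialgebraic ℚ S) (hT : IsSemialgebraic ℚ T)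
    (hSc : S ⊆ cube 2) (hTc : T ⊆ cube 2)
    (hpos : ∀ z ∈ S, (0:ℝ) < 1 + 7 * c * z 0) (hposT : ∀ w ∈ T, 7 * (c:ℝ) * w 0 < 1)
    (hST : ∀ z ∈ S, Tr c z ∈ T) (hTS : ∀ w ∈ T, Ur c w ∈ S) :
    KZ.of (W7.rep.restrict S hS hSc) - KZ.of (W7.rep.restrict T hT hTc) ∈ KZ.relations := by
  let M00 : (Fin 2 → ℝ) → ℝ := fun z => (1 + 7 * (c:ℝ) * c) / ((1 + 7 * c * z 0) * (1 + 7 * c * z 0))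
  let Mz : (Fin 2 → ℝ) → Matrix (Fin 2) (Fin 2) ℝ := fun z => !![M00 z, 0; 0, 1]
  let Φ' : (Fin 2 → ℝ) → (Fin 2 → ℝ) →L[ℝ] (Fin 2 → ℝ) := fun z =>
    LinearMap.toContinuousLinearMap (Matrix.toLin' (Mz z))
  have hΦ'ap : ∀ z w, Φ' z w = ![M00 z * w 0, w 1] := by
    intro z w; funext i
    fin_cases i <;> simp [Φ', Mz, Matrix.toLin'_apply, Matrix.mulVec, dotProduct, Fin.sum_univ_two]
  have hdet : ∀ z, (Φ' z).det = M00 z := by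
    intro z
    unfold ContinuousLinearMap.det
    simp [Φ', LinearMap.det_toLin', Mz, Matrix.det_fin_two]
  have hdom : (W7.rep.restrict T hT hTc).domain = Tr c '' (W7.rep.restrict S hS hSc).domain := by
    simp only [KZ.IntegralRep.domain_restrict]
    ext w
    constructor
    · intro hw
      exact ⟨Ur c w, hTS w hw, Tr_Ur c w (hposT w hw)⟩
    · rintro ⟨z, hz, rfl⟩
      exact hST z hz
  refine KZ.changeOfVariablesRel_subset_relations
    ⟨2, W7.rep.restrict S hS hSc, W7.rep.restrict T hT hTc, Tr c, Φ', ?_, ?_, ?_, hdom, ?_, rfl⟩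
  · have hsd : IsSemialgebraic ℚ (W7.rep.restrict S hS hSc).domain :=
      (W7.rep.restrict S hS hSc).isSemialgebraic_domain
    refine (isSemialgebraicMapOn_iff_forall_holds hsd).mpr fun i => ?_
    fin_cases i
    · refine (isSemialgebraicFunOn_aeval_div_aeval hsd (X 0 - C c) (C 1 + C 7 * C c * X 0) fun z hz => ?_).congr
        fun z _ => ?_
      · have hz' : z ∈ S := by simpa [KZ.IntegralRep.domain_restrict] using hz
        have hD := hpos z hz'
        simp only [map_add, map_mul, aeval_C, aeval_X, eq_ratCast, Rat.cast_ofNat, Rat.cast_one]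
        linarith
      · simp only [Tr, Fin.zero_eta, Matrix.cons_val_zero, map_add, map_sub, map_mul, aeval_C, aeval_X, eq_ratCast,
          Rat.cast_ofNat, Rat.cast_one]
    · exact (isSemialgebraicFunOn_aeval hsd (X 1)).congr fun z _ => by
        simp only [Tr, Fin.mk_one, Matrix.cons_val_one, Matrix.head_cons, Matrix.cons_val_fin_one, aeval_X]
  · intro z hz
    have hz' : z ∈ S := by simpa [KZ.IntegralRep.domain_restrict] using hz
    have hDp := hpos z hz'
    have hDne : (1 + 7 * (c:ℝ) * z 0) ≠ 0 := hDp.ne'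
    have hA := hasFDerivAt_apply (𝕜 := ℝ) 0 z
    have hB := hasFDerivAt_apply (𝕜 := ℝ) 1 z
    have hNum := hA.sub_const (c:ℝ)
    have hDen := (hA.const_mul (7 * (c:ℝ))).const_add (1:ℝ)
    have hinv := (hasDerivAt_inv hDne).comp_hasFDerivAt z hDen
    have hcomp1 := hNum.mul hinv
    have hpi : HasFDerivAt (Tr c) (Φ' z) z := by
      rw [hasFDerivAt_pi']
      intro i
      fin_cases i
      · refine (hcomp1.congr_fderiv ?_).congr_of_eventuallyEq (Filter.Eventually.of_forall fun y => ?_)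
        · ext w
          simp [hΦ'ap, M00]
          field_simp
          ring
        · simp only [Fin.zero_eta, Tr_zero, Function.comp_apply, Pi.mul_apply, Pi.sub_apply, div_eq_mul_inv]
      · refine (hB.congr_fderiv ?_).congr_of_eventuallyEq (Filter.Eventually.of_forall fun y => ?_)
        · ext w
          simp [hΦ'ap]
        · simp only [Fin.mk_one, Tr_one]
    exact hpi.hasFDerivWithinAt
  · intro z₁ hz₁ z₂ hz₂ heq
    have hz₁' : z₁ ∈ S := by simpa [KZ.IntegralRep.domain_restrict] using hz₁
    have hz₂' : z₂ ∈ S := by simpa [KZ.IntegralRep.domain_restrict] using hz₂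
    have h := congr_arg (Ur c) heq
    rwa [Ur_Tr c z₁ (hpos z₁ hz₁'), Ur_Tr c z₂ (hpos z₂ hz₂')] at h
  · intro z hz
    have hz' : z ∈ S := by simpa [KZ.IntegralRep.domain_restrict] using hz
    have hDp := hpos z hz'
    have hDne : (1 + 7 * (c:ℝ) * z 0) ≠ 0 := hDp.ne'
    have h17 : (0:ℝ) < 1 + 7 * c * c := by nlinarith [mul_self_nonneg (c:ℝ)]
    have hM : 0 < M00 z := div_pos h17 (mul_pos hDp hDp)
    rw [hdet z, abs_of_pos hM]
    simp only [M00]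
    simp only [KZ.IntegralRep.integrand_restrict, RFun.rep_integrand]
    simp only [W7, W7Den, RFun.fn, Tr, map_add, map_sub, map_mul, aeval_C, aeval_X, eq_ratCast, Rat.cast_one,
      Rat.cast_ofNat, vec2_0, vec2_1, Matrix.cons_val_zero, Matrix.cons_val_one, Matrix.head_cons]
    have h1 : (0:ℝ) < 1 + 7 * z 0 * z 0 := by nlinarith [mul_self_nonneg (z 0)]
    have h2 : (0:ℝ) < 1 + 7 * z 1 * z 1 := by nlinarith [mul_self_nonneg (z 1)]
    have h1ne := h1.ne'
    have h2ne := h2.ne'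
    have h17ne := h17.ne'
    generalize hDdef : 1 + 7 * (c:ℝ) * z 0 = D at *
    have h3 : (0:ℝ) < 1 + 7 * ((z 0 - c) / D) * ((z 0 - c) / D) := by nlinarith [mul_self_nonneg ((z 0 - c) / D)]
    have h3ne := h3.ne'
    field_simp
    rw [← hDdef]
    ring

/-- the swap `(x,y) ↦ (y,x)`. -/
def Sw (z : Fin 2 → ℝ) : Fin 2 → ℝ := ![z 1, z 0]
/-- Auxiliary step `Sw_zero`: Sw zero. [bookkeeping] -/
theorem Sw_zero (z : Fin 2 → ℝ) : Sw z 0 = z 1 := rfl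
/-- Auxiliary step `Sw_one`: Sw one. [bookkeeping] -/
theorem Sw_one (z : Fin 2 → ℝ) : Sw z 1 = z 0 := rfl
/-- Auxiliary step `Sw_invol`: Sw invol. [bookkeeping] -/
theorem Sw_invol (z : Fin 2 → ℝ) : Sw (Sw z) = z := by
  funext i
  fin_cases i <;> rfl

/-- **The swap as a KZ-move**: `[W₇ | S] ≡ [W₇ | T]` whenever `Sw(S) ⊆ T`, `Sw(T) ⊆ S` (`W₇` is symmetric). -/
theorem W7_swap {S T : Set (Fin 2 → ℝ)} (hS : IsSemialgebraic ℚ S) (hT : IsSemialgebraic ℚ T)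
    (hSc : S ⊆ cube 2) (hTc : T ⊆ cube 2) (hST : ∀ z ∈ S, Sw z ∈ T) (hTS : ∀ w ∈ T, Sw w ∈ S) :
    KZ.of (W7.rep.restrict S hS hSc) - KZ.of (W7.rep.restrict T hT hTc) ∈ KZ.relations := by
  let Mz : Matrix (Fin 2) (Fin 2) ℝ := !![0, 1; 1, 0]
  let Φ' : (Fin 2 → ℝ) → (Fin 2 → ℝ) →L[ℝ] (Fin 2 → ℝ) := fun _ =>
    LinearMap.toContinuousLinearMap (Matrix.toLin' Mz)
  have hΦ'ap : ∀ z w, Φ' z w = ![w 1, w 0] := by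
    intro z w; funext i
    fin_cases i <;> simp [Φ', Mz, Matrix.toLin'_apply, Matrix.mulVec, dotProduct, Fin.sum_univ_two]
  have hdet : ∀ z, (Φ' z).det = -1 := by
    intro z
    unfold ContinuousLinearMap.det
    simp [Φ', LinearMap.det_toLin', Mz, Matrix.det_fin_two]
  have hdom : (W7.rep.restrict T hT hTc).domain = Sw '' (W7.rep.restrict S hS hSc).domain := by
    simp only [KZ.IntegralRep.domain_restrict]
    ext w
    constructor
    · intro hw
      exact ⟨Sw w, hTS w hw, Sw_invol w⟩
    · rintro ⟨z, hz, rfl⟩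
      exact hST z hz
  refine KZ.changeOfVariablesRel_subset_relations
    ⟨2, W7.rep.restrict S hS hSc, W7.rep.restrict T hT hTc, Sw, Φ', ?_, ?_, ?_, hdom, ?_, rfl⟩
  · have hsd : IsSemialgebraic ℚ (W7.rep.restrict S hS hSc).domain :=
      (W7.rep.restrict S hS hSc).isSemialgebraic_domain
    refine (isSemialgebraicMapOn_iff_forall_holds hsd).mpr fun i => ?_
    fin_cases i
    · exact (isSemialgebraicFunOn_aeval hsd (X 1)).congr fun z _ => by
        simp only [Sw, Fin.zero_eta, Matrix.cons_val_zero, aeval_X]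
    · exact (isSemialgebraicFunOn_aeval hsd (X 0)).congr fun z _ => by
        simp only [Sw, Fin.mk_one, Matrix.cons_val_one, Matrix.head_cons, Matrix.cons_val_fin_one, aeval_X]
  · intro z hz
    have hA := hasFDerivAt_apply (𝕜 := ℝ) 0 z
    have hB := hasFDerivAt_apply (𝕜 := ℝ) 1 z
    have hpi : HasFDerivAt Sw (Φ' z) z := by
      rw [hasFDerivAt_pi']
      intro i
      fin_cases i
      · refine (hB.congr_fderiv ?_).congr_of_eventuallyEq (Filter.Eventually.of_forall fun y => ?_)
        · ext w
          simp [hΦ'ap]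
        · simp only [Fin.zero_eta, Sw_zero]
      · refine (hA.congr_fderiv ?_).congr_of_eventuallyEq (Filter.Eventually.of_forall fun y => ?_)
        · ext w
          simp [hΦ'ap]
        · simp only [Fin.mk_one, Sw_one]
    exact hpi.hasFDerivWithinAt
  · intro z₁ hz₁ z₂ hz₂ heq
    have h := congr_arg Sw heq
    rwa [Sw_invol, Sw_invol] at h
  · intro z hz
    rw [hdet z, abs_neg, abs_one, mul_one]
    simp only [KZ.IntegralRep.integrand_restrict, RFun.rep_integrand]
    simp only [W7, W7Den, RFun.fn, Sw, map_add, map_sub, map_mul, aeval_C, aeval_X, eq_ratCast, Rat.cast_one,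
      Rat.cast_ofNat, vec2_0, vec2_1, Matrix.cons_val_zero, Matrix.cons_val_one, Matrix.head_cons]
    ring

/-! ### §19s  First X2 application: `[W₇ | [1/7,3/7]×[1/7,1/3]] ≡ [W₇ | [1/7,3/7]×[0,1/7]]`
(`= W7_swap ∘ W7_translate (1/7) ∘ W7_swap`; `y ↦ (y − 1/7)/(1 + y)` maps `[1/7,1/3]` onto `[0,1/7]`). -/

/-- Auxiliary definition `sX3b` (§19s): s X3b. [bookkeeping] -/
def sX3b : Set (Fin 2 → ℝ) := {z | 3 * z 0 ≤ 1}
/-- Auxiliary step `isSemialgebraic_sX3b` (§19s): is Semialgebraic s X3b. [bookkeeping] -/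
theorem isSemialgebraic_sX3b : IsSemialgebraic ℚ sX3b :=
  isSemialgebraic_of_le (C 3 * X 0) (C 1) sX3b fun z => by
    simp only [sX3b, mem_setOf_eq, map_mul, aeval_C, aeval_X, eq_ratCast, Rat.cast_ofNat, Rat.cast_one]
/-- Auxiliary step `isSemialgebraic_sX7` (§19s): is Semialgebraic s X7. [bookkeeping] -/
theorem isSemialgebraic_sX7 : IsSemialgebraic ℚ sX7 :=
  isSemialgebraic_of_le (C 7 * X 0) (C 1) sX7 fun z => by
    simp only [sX7, mem_setOf_eq, map_mul, aeval_C, aeval_X, eq_ratCast, Rat.cast_ofNat, Rat.cast_one]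
/-- `R1xT = [1/7,1/3]×[1/7,3/7]` (the swap of `R1x`), `R0xT = [0,1/7]×[1/7,3/7]` (the swap of `R0x`). -/
def R1xT : Set (Fin 2 → ℝ) := cube 2 ∩ (sY7c ∩ sY73 ∩ sX7c ∩ sX3b)
/-- Auxiliary definition `R0xT` (§19s): R0x T. [bookkeeping] -/
def R0xT : Set (Fin 2 → ℝ) := cube 2 ∩ (sY7c ∩ sY73 ∩ sX7)
/-- Auxiliary step `isSemialgebraic_R1xT` (§19s): is Semialgebraic R1x T. [bookkeeping] -/
theorem isSemialgebraic_R1xT : IsSemialgebraic ℚ R1xT :=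
  KZ.isSemialgebraic_cube.inter
    (((isSemialgebraic_sY7c.inter isSemialgebraic_sY73).inter isSemialgebraic_sX7c).inter isSemialgebraic_sX3b)
/-- Auxiliary step `isSemialgebraic_R0xT` (§19s): is Semialgebraic R0x T. [bookkeeping] -/
theorem isSemialgebraic_R0xT : IsSemialgebraic ℚ R0xT :=
  KZ.isSemialgebraic_cube.inter ((isSemialgebraic_sY7c.inter isSemialgebraic_sY73).inter isSemialgebraic_sX7)
/-- Auxiliary definition `W7R1xT` (§19s): W7 R1x T. [bookkeeping] -/
def W7R1xT : KZ.IntegralRep 2 := W7.rep.restrict R1xT isSemialgebraic_R1xT (fun _ hz => hz.1)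
/-- Auxiliary definition `W7R0xT` (§19s): W7 R0x T. [bookkeeping] -/
def W7R0xT : KZ.IntegralRep 2 := W7.rep.restrict R0xT isSemialgebraic_R0xT (fun _ hz => hz.1)

/-- Auxiliary step `W7R1x_R1xT` (§19s): W7 R1x R1x T. [bookkeeping] -/
theorem W7R1x_R1xT : KZ.of W7R1x - KZ.of W7R1xT ∈ KZ.relations := by
  refine W7_swap isSemialgebraic_R1x isSemialgebraic_R1xT (fun _ hz => hz.1) (fun _ hz => hz.1)
    (fun z hz => ?_) (fun w hw => ?_)
  · obtain ⟨hcu, ⟨⟨⟨x7, x3⟩, y7⟩, y3⟩⟩ := hz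
    have h0 := (cube2 hcu).1
    have h1 := (cube2 hcu).2
    simp only [sX7c, sX3, sY7c, sY3, mem_setOf_eq] at x7 x3 y7 y3
    refine ⟨?_, ⟨⟨⟨?_, ?_⟩, ?_⟩, ?_⟩⟩
    · intro i
      fin_cases i
      · exact h1
      · exact h0
    · simp only [sY7c, mem_setOf_eq, Sw_one]; exact x7
    · simp only [sY73, mem_setOf_eq, Sw_one]; exact x3
    · simp only [sX7c, mem_setOf_eq, Sw_zero]; exact y7
    · simp only [sX3b, mem_setOf_eq, Sw_zero]; exact y3
  · obtain ⟨hcu, ⟨⟨⟨y7, y73⟩, x7⟩, x3b⟩⟩ := hw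
    have h0 := (cube2 hcu).1
    have h1 := (cube2 hcu).2
    simp only [sX7c, sX3b, sY7c, sY73, mem_setOf_eq] at x7 x3b y7 y73
    refine ⟨?_, ⟨⟨⟨?_, ?_⟩, ?_⟩, ?_⟩⟩
    · intro i
      fin_cases i
      · exact h1
      · exact h0
    · simp only [sX7c, mem_setOf_eq, Sw_zero]; exact y7
    · simp only [sX3, mem_setOf_eq, Sw_zero]; exact y73
    · simp only [sY7c, mem_setOf_eq, Sw_one]; exact x7
    · simp only [sY3, mem_setOf_eq, Sw_one]; exact x3b

/-- Auxiliary step `W7R1xT_R0xT` (§19s): W7 R1x T R0x T. [bookkeeping] -/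
theorem W7R1xT_R0xT : KZ.of W7R1xT - KZ.of W7R0xT ∈ KZ.relations := by
  have hc : (((1:ℚ) / 7 : ℚ) : ℝ) = 1 / 7 := by norm_num
  refine W7_translate (1 / 7) isSemialgebraic_R1xT isSemialgebraic_R0xT (fun _ hz => hz.1) (fun _ hz => hz.1)
    (fun z hz => ?_) (fun w hw => ?_) (fun z hz => ?_) (fun w hw => ?_)
  · have h0 := (cube2 hz.1).1
    rw [hc]; linarith
  · obtain ⟨hcu, ⟨_, x7⟩⟩ := hw
    simp only [sX7, mem_setOf_eq] at x7
    rw [hc]; linarith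
  · obtain ⟨hcu, ⟨⟨⟨y7, y73⟩, x7⟩, x3b⟩⟩ := hz
    have h0 := (cube2 hcu).1
    have h1 := (cube2 hcu).2
    simp only [sX7c, sX3b, sY7c, sY73, mem_setOf_eq] at x7 x3b y7 y73
    have hD : (0:ℝ) < 1 + 7 * (1 / 7) * z 0 := by linarith
    have key0 : 0 ≤ (z 0 - 1 / 7) / (1 + 7 * (1 / 7) * z 0) := div_nonneg (by linarith) hD.le
    have key1 : (z 0 - 1 / 7) / (1 + 7 * (1 / 7) * z 0) ≤ 1 / 7 := by
      rw [div_le_iff₀ hD]; linarith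
    have e0 : Tr (1 / 7) z 0 = (z 0 - 1 / 7) / (1 + 7 * (1 / 7) * z 0) := by rw [Tr_zero, hc]
    refine ⟨?_, ⟨⟨?_, ?_⟩, ?_⟩⟩
    · intro i
      fin_cases i
      · show 0 ≤ Tr (1 / 7) z 0 ∧ Tr (1 / 7) z 0 ≤ 1
        rw [e0]; constructor <;> linarith
      · exact h1
    · simp only [sY7c, mem_setOf_eq, Tr_one]; exact y7
    · simp only [sY73, mem_setOf_eq, Tr_one]; exact y73
    · simp only [sX7, mem_setOf_eq]; rw [e0]; linarith
  · obtain ⟨hcu, ⟨⟨y7, y73⟩, x7⟩⟩ := hw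
    have h0 := (cube2 hcu).1
    have h1 := (cube2 hcu).2
    simp only [sX7, sY7c, sY73, mem_setOf_eq] at x7 y7 y73
    have hE : (0:ℝ) < 1 - 7 * (1 / 7) * w 0 := by linarith
    have key0 : 0 ≤ (w 0 + 1 / 7) / (1 - 7 * (1 / 7) * w 0) := div_nonneg (by linarith) hE.le
    have key1 : 1 / 7 ≤ (w 0 + 1 / 7) / (1 - 7 * (1 / 7) * w 0) := by
      rw [le_div_iff₀ hE]; linarith
    have key2 : (w 0 + 1 / 7) / (1 - 7 * (1 / 7) * w 0) ≤ 1 / 3 := by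
      rw [div_le_iff₀ hE]; linarith
    have e0 : Ur (1 / 7) w 0 = (w 0 + 1 / 7) / (1 - 7 * (1 / 7) * w 0) := by rw [Ur_zero, hc]
    refine ⟨?_, ⟨⟨⟨?_, ?_⟩, ?_⟩, ?_⟩⟩
    · intro i
      fin_cases i
      · show 0 ≤ Ur (1 / 7) w 0 ∧ Ur (1 / 7) w 0 ≤ 1
        rw [e0]; constructor <;> linarith
      · exact h1
    · simp only [sY7c, mem_setOf_eq, Ur_one]; exact y7
    · simp only [sY73, mem_setOf_eq, Ur_one]; exact y73
    · simp only [sX7c, mem_setOf_eq]; rw [e0]; linarith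
    · simp only [sX3b, mem_setOf_eq]; rw [e0]; linarith

/-- Auxiliary step `W7R0xT_R0x` (§19s): W7 R0x T R0x. [bookkeeping] -/
theorem W7R0xT_R0x : KZ.of W7R0xT - KZ.of W7R0x ∈ KZ.relations := by
  refine W7_swap isSemialgebraic_R0xT isSemialgebraic_R0x (fun _ hz => hz.1) (fun _ hz => hz.1)
    (fun z hz => ?_) (fun w hw => ?_)
  · obtain ⟨hcu, ⟨⟨y7, y73⟩, x7⟩⟩ := hz
    have h0 := (cube2 hcu).1
    have h1 := (cube2 hcu).2
    simp only [sX7, sY7c, sY73, mem_setOf_eq] at x7 y7 y73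
    refine ⟨?_, ⟨⟨?_, ?_⟩, ?_⟩⟩
    · intro i
      fin_cases i
      · exact h1
      · exact h0
    · simp only [sX7c, mem_setOf_eq, Sw_zero]; exact y7
    · simp only [sX3, mem_setOf_eq, Sw_zero]; exact y73
    · simp only [sY7, mem_setOf_eq, Sw_one]; exact x7
  · obtain ⟨hcu, ⟨⟨x7, x3⟩, y7⟩⟩ := hw
    have h0 := (cube2 hcu).1
    have h1 := (cube2 hcu).2
    simp only [sX7c, sX3, sY7, mem_setOf_eq] at x7 x3 y7
    refine ⟨?_, ⟨⟨?_, ?_⟩, ?_⟩⟩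
    · intro i
      fin_cases i
      · exact h1
      · exact h0
    · simp only [sY7c, mem_setOf_eq, Sw_one]; exact x7
    · simp only [sY73, mem_setOf_eq, Sw_one]; exact x3
    · simp only [sX7, mem_setOf_eq, Sw_zero]; exact y7

/-- **`[W₇ | [1/7,3/7]×[1/7,1/3]] ≡ [W₇ | [1/7,3/7]×[0,1/7]]`** — both are `β × α₁` lattice rectangles. -/
theorem W7R1x_R0x : KZ.of W7R1x - KZ.of W7R0x ∈ KZ.relations := by
  have h := add_mem (add_mem W7R1x_R1xT W7R1xT_R0xT) W7R0xT_R0x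
  convert h using 1
  abel

end Fold
end Summit.KontsevichZagierPeriods.RootDecompQuadraticDescent.Pair18Homotopy
end
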